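import Summits.BirchSwinnertonDyer.BirchSwinnertonDyer.Theorems.RamifiedSevenEllipticUnitsIntegralEvaluationTransfer
import Mathlib.NumberTheory.Padics.Complex
import HarnessLib

set_option linter.dupNamespace false
set_option autoImplicit false

/-!
# K7r crux `EllipticUnitValueSevenOfGZK` (stmt-BirchSwinnertonDyer-19945), line `rubin-formula-zp` v3,
# stub S_relval — the `ℚ̄_p = PadicAlgCl p` / `ℂ_[p]` instances of the field-valued transfer chain and
# the `ℚ̄_p` ENDGAME in squared currency (pure valuation algebra; cell `bsd-cm`, seat `bsd-cm-k7r-c3`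
# g9; helper, `--supports` 19945; companion of `…IntegralEvaluationTransfer.lean`)

HONEST FRAMING. Nothing here is about elliptic curves or `L`-functions; nothing is asserted about the
crux; BSD is not proved by any of this. The [BKNO] interface of the tree reads `p`-adic values of
complex numbers through the embedding datum `ι : ℚ̄_p ≃+* ℂ` (`EllipticUnitClassData.erl`:
`((ι.symm z : PadicAlgCl p) : ℂ_[p])`; littype-02's `‖ι.symm ·‖` files), i.e. in the valued FIELDS
`PadicAlgCl p` / `ℂ_[p]` with `Valued.v = ‖·‖₊ ∈ ℝ≥0` and `v p = 1/p`. Should the (T4) typing of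
[BKNO] Def. 4.7 / Thm. 4.12 (tabled with bsd-littype-10) evaluate `𝓛` into that currency, the companion's
integral-image transfer applies verbatim; THIS FILE supplies the currency-specific facts:
* integrality of evaluations through `𝓞_ℂ_[p]` and through `ℤ_[p] → ℚ_[p] → ℚ̄_p`;
* `Valued.v ((q : ℚ) : PadicAlgCl p) = p^(−padicValRat p q)` (and in `ℂ_[p]`); **`ι.symm` FIXES `ℚ`**
  (`ι.symm (q : ℂ) = q`, so a RATIONAL central-value ratio `r = (L_W/L_{W₀})²` — the v3 currency of
  seat k7r-c4 — has `p`-adic valuation `p^(−padicValRat p r)` whatever `ι` is); the squared bridge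
  `ρ² = ι.symm r ⇒ (Valued.v ρ)² = p^(−padicValRat p r)`;
* the threshold in `ℚ̄_p`: `(Valued.v y)² = v p`, `p ≥ 5` ⇒ `Valued.v ((1+y)^{p^m} − 1) = (v y)^{1+2m}`
  with square `p^(−(1+2m))`;
* the `ℚ̄_p` ENDGAME `natCast_eq_padicValRat_of_interpolation_padicAlgCl`: for an integral-image
  `ev : R⟦X⟧ →+* ℚ̄_p` at `ev X = u^{p^m} − 1`, (F2) `(Valued.v (u − 1))² = v p`, the interpolation
  identities [(iii)], `v per = v per₀` [(iv)], `v ℓ₀ = 1` [(v)], `ρ² = ι.symm r`, `r ∈ ℚ^×`,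
  `padicValRat p r < 1 + 2m`, bottom reading `(Valued.v (ev (C (F 0))))² = p^(−l)` [Thm 7.2 at 𝟙]:
  `(l : ℤ) = padicValRat p r` — the conclusion of S_relval.
All [BKNO]-dependent objects and inputs are HYPOTHESES about elements of `ℚ̄_p`; nothing is
constructed; no statement item is filed.
References: [BKNO] arXiv:2608.06879 Def. 4.7, Thm. 4.12, Thm. 7.2 (shapes only)
[BurungaleKobayashiNakamuraOta2026]; J.-P. Serre, *Local Fields* (1979) Ch. II §1, Ch. XIV §4 Prop. 9
[Serre1979]; J. Neukirch, *Algebraic Number Theory* (1999) Ch. II (4.8) [NeukirchANT1999];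
memo RELATIVE-RUBIN-ram-g9.md §1.
-/

noncomputable section

namespace Summit.BirchSwinnertonDyer.BirchSwinnertonDyer.Theorems.RamifiedSevenEllipticUnits.Ultrametric

open PowerSeries NNReal

/-! ## The `ℚ̄_p = PadicAlgCl p` / `ℂ_[p]` instances (`Valued.v = ‖·‖₊`, `v p = 1/p`) -/

section PadicComplexCurrency

variable {p : ℕ} [hp : Fact p.Prime] {R : Type*} [CommRing R]

/-- An evaluation `R⟦X⟧ → 𝓞_ℂ_[p] ↪ ℂ_[p]` has integral image.
[cite: Serre1979, Ch. II §1] -/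
theorem forall_valued_le_one_of_padicComplexInt (ev₀ : R⟦X⟧ →+* 𝓞_ℂ_[p]) :
    ∀ G : R⟦X⟧, Valued.v (((𝓞_ℂ_[p]).subtype.comp ev₀) G) ≤ 1 :=
  fun G ↦ (Valuation.mem_valuationSubring_iff _ _).1 (ev₀ G).2

/-- `ℤ_[p] → ℚ_[p] → ℚ̄_p` lands in `{v ≤ 1}`: `Valued.v (z : PadicAlgCl p) ≤ 1` for `z ∈ ℤ_[p]`.
[cite: Serre1979, Ch. II §1] -/
theorem valued_padicAlgCl_padicInt_le_one (z : ℤ_[p]) :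
    Valued.v (algebraMap ℚ_[p] (PadicAlgCl p) (z : ℚ_[p])) ≤ 1 := by
  rw [← NNReal.coe_le_coe, PadicAlgCl.valuation_coe, NNReal.coe_one]
  calc ‖algebraMap ℚ_[p] (PadicAlgCl p) (z : ℚ_[p])‖ = ‖(z : ℚ_[p])‖ := PadicAlgCl.norm_extends p _
    _ ≤ 1 := PadicInt.norm_le_one z

/-- An evaluation `R⟦X⟧ → ℤ_[p] → ℚ̄_p` has integral image. [cite: Serre1979, Ch. II §1] -/
theorem forall_valued_le_one_of_padicInt_padicAlgCl (ev₀ : R⟦X⟧ →+* ℤ_[p]) :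
    ∀ G : R⟦X⟧, Valued.v ((((algebraMap ℚ_[p] (PadicAlgCl p)).comp PadicInt.Coe.ringHom).comp ev₀)
      G) ≤ 1 :=
  fun G ↦ valued_padicAlgCl_padicInt_le_one (ev₀ G)

/-- **`v_p` of a rational in `ℚ̄_p`**: `Valued.v ((q : ℚ) : PadicAlgCl p) = p^(−padicValRat p q)` for
`q ≠ 0`. [cite: NeukirchANT1999, Ch. II (4.8)] -/
theorem valued_ratCast_padicAlgCl {q : ℚ} (hq : q ≠ 0) :
    Valued.v ((q : ℚ) : PadicAlgCl p) = (p : ℝ≥0) ^ (-padicValRat p q) := by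
  have hcast : ((q : ℚ) : PadicAlgCl p) = algebraMap ℚ_[p] (PadicAlgCl p) (q : ℚ_[p]) :=
    (map_ratCast (algebraMap ℚ_[p] (PadicAlgCl p)) q).symm
  have hq' : (q : ℚ_[p]) ≠ 0 := by exact_mod_cast hq
  apply NNReal.coe_injective
  rw [PadicAlgCl.valuation_coe, hcast, PadicAlgCl.norm_extends p,
    Padic.norm_eq_zpow_neg_valuation hq', Padic.valuation_ratCast, NNReal.coe_zpow, NNReal.coe_natCast]

/-- … and in `ℂ_[p]`: `Valued.v ((q : ℚ) : ℂ_[p]) = p^(−padicValRat p q)` for `q ≠ 0`.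
[cite: NeukirchANT1999, Ch. II (4.8)] -/
theorem valued_ratCast_padicComplex {q : ℚ} (hq : q ≠ 0) :
    Valued.v ((q : ℚ) : ℂ_[p]) = (p : ℝ≥0) ^ (-padicValRat p q) := by
  have hcast : ((q : ℚ) : ℂ_[p]) = (((q : ℚ) : PadicAlgCl p) : ℂ_[p]) := by
    rw [PadicComplex.coe_eq, map_ratCast]
  rw [hcast, PadicComplex.valuation_extends, valued_ratCast_padicAlgCl hq]

/-- **`ι.symm` FIXES `ℚ`**: for the embedding datum `ι : ℚ̄_p ≃+* ℂ` of the [BKNO] interface,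
`ι.symm (q : ℂ) = (q : ℚ̄_p)` — a rational central-value ratio `r` is transported to itself, so its
`p`-adic valuation is `p^(−padicValRat p r)` whatever `ι` is. [cite: NeukirchANT1999, Ch. II (4.8)] -/
theorem ringEquiv_symm_ratCast (ι : PadicAlgCl p ≃+* ℂ) (q : ℚ) :
    ι.symm (q : ℂ) = (q : PadicAlgCl p) :=
  map_ratCast ι.symm q

/-- Hence `Valued.v (ι.symm (q : ℂ)) = p^(−padicValRat p q)` for `q ≠ 0`.
[cite: NeukirchANT1999, Ch. II (4.8)] -/
theorem valued_ringEquiv_symm_ratCast (ι : PadicAlgCl p ≃+* ℂ) {q : ℚ} (hq : q ≠ 0) :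
    Valued.v (ι.symm (q : ℂ)) = (p : ℝ≥0) ^ (-padicValRat p q) := by
  rw [ringEquiv_symm_ratCast, valued_ratCast_padicAlgCl hq]

/-- **`ord ρ = ½·ord(ρ²)` in `ℚ̄_p`, squared currency**: `ρ² = ι.symm (r : ℂ)` (`r ∈ ℚ^×`, e.g.
`ρ = ι.symm (L_W/L_{W₀})` with `(L_W/L_{W₀})² = r`) ⇒ `(Valued.v ρ)² = p^(−padicValRat p r)`.
[cite: NeukirchANT1999, Ch. II (4.8)] -/
theorem valued_sq_eq_of_sq_eq_symm_ratCast (ι : PadicAlgCl p ≃+* ℂ) {r : ℚ} (hr : r ≠ 0)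
    {ρ : PadicAlgCl p} (hρ : ρ ^ 2 = ι.symm (r : ℂ)) :
    Valued.v ρ ^ 2 = (p : ℝ≥0) ^ (-padicValRat p r) := by
  rw [← map_pow, hρ, valued_ringEquiv_symm_ratCast ι hr]

/-- `v p = 1/p` in `ℚ̄_p` is neither `0` nor `≥ 1`. [cite: NeukirchANT1999, Ch. II (4.8)] -/
theorem valued_natCast_padicAlgCl_ne_zero_and_lt_one :
    Valued.v (p : PadicAlgCl p) ≠ 0 ∧ Valued.v (p : PadicAlgCl p) < 1 := by
  have h1 : (1 : ℝ≥0) < (p : ℝ≥0) := by exact_mod_cast hp.out.one_lt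
  rw [PadicAlgCl.valuation_p, one_div]
  exact ⟨inv_ne_zero (ne_of_gt (lt_trans zero_lt_one h1)), inv_lt_one_of_one_lt₀ h1⟩

/-- **The threshold in `ℚ̄_p`**: for `p ≥ 5` and `y` with `(Valued.v y)² = Valued.v p = 1/p`
(`ord_π y = 1`, `e = 2`): `Valued.v ((1 + y)^(p^m) − 1) = (Valued.v y)^(1 + 2m)`, whose square is
`p^(−(1 + 2m))`. [cite: Serre1979, Ch. XIV §4, Prop. 9 (proof)] -/
theorem valued_one_add_pow_prime_pow_sub_one_padicAlgCl (h5 : 5 ≤ p) {y : PadicAlgCl p}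
    (hy : Valued.v y ^ 2 = Valued.v (p : PadicAlgCl p)) (m : ℕ) :
    Valued.v ((1 + y) ^ (p ^ m) - 1) = Valued.v y ^ (1 + 2 * m) ∧
      Valued.v ((1 + y) ^ (p ^ m) - 1) ^ 2 = (p : ℝ≥0) ^ (-(1 + 2 * (m : ℤ))) := by
  have h := map_one_add_pow_prime_pow_sub_one_of_sq_eq Valued.v hp.out h5
    valued_natCast_padicAlgCl_ne_zero_and_lt_one.1 valued_natCast_padicAlgCl_ne_zero_and_lt_one.2 hy m
  refine ⟨h, ?_⟩
  rw [h, ← pow_mul, mul_comm, pow_mul, hy, PadicAlgCl.valuation_p, one_div, inv_pow, ← zpow_natCast,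
    ← zpow_neg]
  congr 1

/-- **THE `ℚ̄_p` ENDGAME (squared currency) — the conclusion of S_relval from typed inputs, all as
hypotheses about elements of `ℚ̄_p = PadicAlgCl p`.** For an integral-image evaluation
`ev : R⟦X⟧ →+* ℚ̄_p` of `F = 𝓛_W` at `ev X = u^{p^m} − 1` with (F2) `(Valued.v (u − 1))² = Valued.v p`,
`p ≥ 5`, the interpolation identities `ev F · per = A₀ · ρ`, `ℓ₀ · per₀ = A₀` (`A₀ ≠ 0`) [(iii)],
`v per = v per₀` [(iv)], `v ℓ₀ = 1` [(v)], `ρ² = ι.symm r` with `r ∈ ℚ^×`, the threshold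
`padicValRat p r < 1 + 2m`, and the bottom reading `(Valued.v (ev (C (F 0))))² = p^(−l)` [Thm 7.2 at
𝟙]: **`(l : ℤ) = padicValRat p r`**. [cite: BurungaleKobayashiNakamuraOta2026, Thm. 4.12, Def. 4.7 and Thm. 7.2 (arXiv:2608.06879 pp. 27, 32, 41) (claim; preprint; shape only)] -/
theorem natCast_eq_padicValRat_of_interpolation_padicAlgCl (h5 : 5 ≤ p) (ι : PadicAlgCl p ≃+* ℂ)
    (ev : R⟦X⟧ →+* PadicAlgCl p) (hint : ∀ G : R⟦X⟧, Valued.v (ev G) ≤ 1) (F : R⟦X⟧)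
    {u ℓ₀ per per₀ A₀ ρ : PadicAlgCl p} {m l : ℕ} {r : ℚ}
    (hu : Valued.v (u - 1) ^ 2 = Valued.v (p : PadicAlgCl p)) (hX : ev X = u ^ (p ^ m) - 1)
    (hD : ev F * per = A₀ * ρ) (hD₀ : ℓ₀ * per₀ = A₀) (hper : Valued.v per = Valued.v per₀)
    (hunit : Valued.v ℓ₀ = 1) (hA₀ : A₀ ≠ 0) (hr : r ≠ 0) (hρ : ρ ^ 2 = ι.symm (r : ℂ))
    (hlt : padicValRat p r < 1 + 2 * (m : ℤ))
    (hbottom : Valued.v (ev (C (constantCoeff F))) ^ 2 = (p : ℝ≥0) ^ (-(l : ℤ))) :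
    (l : ℤ) = padicValRat p r := by
  have hp1 : (1 : ℝ≥0) < (p : ℝ≥0) := by exact_mod_cast hp.out.one_lt
  have hvρ := valued_sq_eq_of_sq_eq_symm_ratCast ι hr hρ
  have hA₀' : Valued.v A₀ ≠ 0 := (Valuation.ne_zero_iff _).2 hA₀
  have hx2 : Valued.v (ev X) ^ 2 = (p : ℝ≥0) ^ (-(1 + 2 * (m : ℤ))) := by
    have h := (valued_one_add_pow_prime_pow_sub_one_padicAlgCl h5 hu m).2
    rw [add_sub_cancel] at h
    rw [hX]
    exact h
  have hlt' : Valued.v (ev X) < Valued.v ρ := by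
    rw [← pow_lt_pow_iff_left₀ zero_le zero_le two_ne_zero, hx2, hvρ, zpow_lt_zpow_iff_right₀ hp1]
    linarith
  have h := map_constantCoeff_eq_of_interpolation_of_lt_of_integral Valued.v ev hint F hD hD₀ hper
    hunit hA₀' hlt'
  have h2 : (p : ℝ≥0) ^ (-(l : ℤ)) = (p : ℝ≥0) ^ (-padicValRat p r) := by rw [← hbottom, h, hvρ]
  have h3 := (zpow_right_strictMono₀ hp1).injective h2
  linarith

end PadicComplexCurrency

end Summit.BirchSwinnertonDyer.BirchSwinnertonDyer.Theorems.RamifiedSevenEllipticUnits.Ultrametric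

end
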